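import Summits.AnomalousDissipation.AnomalousDissipation.Theorems.SawtoothPulseCascadeK1LocalisedCascadeCornerTraceTools

/-!
# K1loc, line `Spectral` / thin start — helper: THE CORNER-TRACE ESTIMATE, PER FREQUENCY (S-D constants, «CT» 2/3)

Helper file of the prover lane on the crux `K1LocalisedCascade` (stmt-AnomalousDissipation-19491), route
`SawtoothPulseCascade` (S-D fibre ledger; arbiter A23-7 (3): corner-trace track).  For the exact `N`-tooth chirp `g₀` with lobe
`λ = L₂` and coefficients `c` on `S` (`|l| ≤ L`), the window coefficient `(g₀T)^(k) = Σ_l c_l ĝ₀(k−l)` is controlled, for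
`|k| + L + D ≤ L₂`, by the residue-class sums `A^∓(k) = Σ_{l≡k (N)} c_l e^{∓iπl/(2N)}` (whose squares add up to corner traces of `T`,
`…CornerTraceSum`) and a Cauchy–Schwarz remainder:
* §1 **`fourierCoeff_nTooth_exactChirp`**: `ĝ₀(m) = [N∣m]·sin(π(λ+m)/(2N))·(N/(π(λ+m)) + N/(π(λ−m)))`;
* §2 `ofReal_sin_corner` and **`cornerTrace_term_sq_le`**:
  `|Σ_l c_l ĝ₀(k−l)|² ≤ 3(Φ₀(k)/2)²·(|A⁻(k)|² + |A⁺(k)|² + (4L²M/D²)·Σ_{l≡k}|c_l|²)`, `Φ₀(k) = N/(π(λ+k)) + N/(π(λ−k))`.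
No definitions; nothing about the crux. [cite: Grafakos2014, Prop. 3.1.2 (5), §3.1.3] [problem: turb]
-/

-- `Summit.<Summit>.<Problem>`: single-conjunct summit, the duplicate namespace segment is deliberate.
set_option linter.dupNamespace false

noncomputable section

namespace Summit.AnomalousDissipation.AnomalousDissipation.Theorems.SawtoothPulseCascade.K1Window

open MeasureTheory Set Filter Topology Function Complex AddCircle
open scoped Real
open Literature.Analysis Literature.Analysis.FunctionSpaces Literature.Analysis.FunctionSpaces.Torus Literature.Analysis.FluidPDE
open Literature.Analysis.FluidPDE.SawtoothCascade
open Summit.AnomalousDissipation.AnomalousDissipation.Theorems.SawtoothPulseCascade.K1Start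

/-! ## §1 The coefficients of the `N`-tooth exact chirp -/

/-- **Coefficients of the exact `N`-tooth chirp**: for `g₀(t) = exp(−2πiλ·tri(2πNt)/(2πN))` (`λ ∈ ℤ`, `N ≥ 1`) and `m` with
`λ ± m ≠ 0`: `ĝ₀(m) = 0` unless `N ∣ m`, and then `ĝ₀(m) = sin(π(λ+m)/(2N))·(N/(π(λ+m)) + N/(π(λ−m)))`
(`ĝ₀(Nq) = ĥ(q)` for the one-tooth chirp of strain `λ/N`, `…SidebandEnergy`, and the closed form of `…ChirpCoeff`/`…CornerTraceTools`).
[cite: Grafakos2014, Prop. 3.1.2 (5)] -/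
theorem fourierCoeff_nTooth_exactChirp {N : ℕ} (hN : 0 < N) (lam : ℤ) {g₀ : UnitAddCircle → ℂ}
    (hg₀ : ∀ t : ℝ, g₀ (t : UnitAddCircle) = Complex.exp (-(2 * π * I * lam * ((tri (2 * π * N * t) / (2 * π * N) : ℝ) : ℂ))))
    {m : ℤ} (hm₁ : lam + m ≠ 0) (hm₂ : lam - m ≠ 0) :
    fourierCoeff g₀ m = if (N : ℤ) ∣ m then
      ((Real.sin (π * (lam + m) / (2 * N)) * ((N : ℝ) / (π * (lam + m)) + (N : ℝ) / (π * (lam - m))) : ℝ) : ℂ) else 0 := by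
  have hNr : (0 : ℝ) < N := by exact_mod_cast hN
  set μ : ℝ := (lam : ℝ) / N with hμ
  obtain ⟨h, hhc, hh⟩ := exists_exactChirp_real μ
  have hgh : g₀ = fun z : UnitAddCircle => h (N • z) := by
    funext z
    obtain ⟨u, rfl⟩ := QuotientAddGroup.mk_surjective z
    have e : (N • (QuotientAddGroup.mk u : UnitAddCircle)) = (((N : ℝ) * u : ℝ) : UnitAddCircle) := by
      rw [show (QuotientAddGroup.mk u : UnitAddCircle) = ((u : ℝ) : UnitAddCircle) from rfl, nsmul_coe]
    rw [e, hh, show (QuotientAddGroup.mk u : UnitAddCircle) = ((u : ℝ) : UnitAddCircle) from rfl, hg₀]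
    congr 1
    rw [hμ]
    push_cast
    field_simp
  split_ifs with hdvd
  · obtain ⟨q, rfl⟩ := hdvd
    have hc : fourierCoeff g₀ ((N : ℤ) * q) = fourierCoeff h q := by rw [hgh]; exact fourierCoeff_comp_nsmul_mul hN hhc q
    have h1 : μ + q ≠ 0 := by
      rw [hμ]; intro h0
      have : ((lam : ℝ) + N * q) = 0 := by field_simp at h0; linarith
      exact hm₁ (by exact_mod_cast this)
    have h2 : μ - q ≠ 0 := by
      rw [hμ]; intro h0
      have : ((lam : ℝ) - N * q) = 0 := by field_simp at h0; linarith
      exact hm₂ (by exact_mod_cast this)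
    rw [hc, fourierCoeff_exactChirp_eq hh hhc h1 h2, chirpCoeff_eq_sin_mul]
    congr 1
    rw [hμ]
    push_cast
    have e1 : π * ((lam : ℝ) / N + q) / 2 = π * (lam + N * q) / (2 * N) := by field_simp
    have e2 : 1 / (π * ((lam : ℝ) / N + q)) = N / (π * (lam + N * q)) := by
      rw [show (lam : ℝ) / N + q = (lam + N * q) / N by field_simp]; field_simp
    have e3 : 1 / (π * ((lam : ℝ) / N - q)) = N / (π * (lam - N * q)) := by
      rw [show (lam : ℝ) / N - q = (lam - N * q) / N by field_simp]; field_simp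
    rw [e1, e2, e3]
  · rw [hgh]; exact fourierCoeff_comp_nsmul_eq_zero hN hhc hdvd

/-! ## §2 The per-frequency corner-trace estimate -/

/-- `sin(π(λ+m)/(2N))` as a difference of the corner phases: with `E = e^{iπλ/(2N)}`, `ω_x = e^{iπx/(2N)}`,
`sin(π(λ+k−l)/(2N)) = (E·ω_k·ω̄_l − Ē·ω̄_k·ω_l)/(2i)`. [folklore] -/
theorem ofReal_sin_corner (N : ℕ) (lam k l : ℤ) :
    ((Real.sin (π * (lam + ((k - l : ℤ) : ℝ)) / (2 * N)) : ℝ) : ℂ) =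
      (Complex.exp (π * I * lam / (2 * N)) * Complex.exp (π * I * k / (2 * N)) * Complex.exp (-(π * I * l / (2 * N))) -
        Complex.exp (-(π * I * lam / (2 * N))) * Complex.exp (-(π * I * k / (2 * N))) * Complex.exp (π * I * l / (2 * N))) /
        (2 * I) := by
  rw [ofReal_sin_eq_exp_sub]
  congr 2
  · rw [← Complex.exp_add, ← Complex.exp_add]; congr 1; push_cast; ring
  · rw [← Complex.exp_add, ← Complex.exp_add]; congr 1; push_cast; ring

set_option maxHeartbeats 400000 in
/-- **Per-frequency corner-trace estimate**: with the data of `…CornerTraceSum.cornerTrace_sum_sq_le` (see there), for every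
`k` in the window, `|Σ_l c_l ĝ₀(k−l)|² ≤ 3(Φ₀(k)/2)²·(|A⁻(k)|² + |A⁺(k)|² + (4L²M/D²)·e(k))`, where `Φ₀(k) = N/(π(L₂+k)) + N/(π(L₂−k))`,
`A^∓(k) = Σ_{l∈S, N∣k−l} c_l e^{∓iπl/(2N)}`, `e(k) = Σ_{l∈S, N∣k−l}|c_l|²`: the closed form of `ĝ₀`, the split
`Φ(k,l) = Φ₀(k) + O(|l|Φ₀(k)/D)` and Cauchy–Schwarz on the residue class. [cite: Grafakos2014, Prop. 3.1.2 (5), §3.1.3] -/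
theorem cornerTrace_term_sq_le {N : ℕ} (hN : 0 < N) {L₂ : ℕ} {g₀ : UnitAddCircle → ℂ}
    (hg₀ : ∀ t : ℝ, g₀ (t : UnitAddCircle) =
      Complex.exp (-(2 * π * I * ((L₂ : ℤ) : ℂ) * ((tri (2 * π * N * t) / (2 * π * N) : ℝ) : ℂ))))
    (c : ℤ → ℂ) (S : Finset ℤ) {L D : ℕ} (hD : 0 < D) (hS : ∀ l ∈ S, |l| ≤ L) {M : ℝ}
    (hM : ∀ k : ℤ, (((S.filter fun l => (N : ℤ) ∣ k - l).card : ℕ) : ℝ) ≤ M)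
    (W : Finset ℤ) (hW : ∀ k ∈ W, |k| + L + D ≤ (L₂ : ℤ)) :
    ∀ k ∈ W, ‖∑ l ∈ S, c l * fourierCoeff g₀ (k - l)‖ ^ 2 ≤
      3 * (((N : ℝ) / (π * ((L₂ : ℝ) + k)) + (N : ℝ) / (π * ((L₂ : ℝ) - k))) / 2) ^ 2 *
        (‖∑ l ∈ S.filter (fun l => (N : ℤ) ∣ k - l), c l * Complex.exp (-(π * I * l / (2 * N)))‖ ^ 2 +
          ‖∑ l ∈ S.filter (fun l => (N : ℤ) ∣ k - l), c l * Complex.exp (π * I * l / (2 * N))‖ ^ 2 +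
          4 * (L : ℝ) ^ 2 * M / D ^ 2 * ∑ l ∈ S.filter (fun l => (N : ℤ) ∣ k - l), ‖c l‖ ^ 2) := by
  classical
  have hπ : 0 < π := Real.pi_pos
  have hNr : (0 : ℝ) < N := by exact_mod_cast hN
  have hNz : (0 : ℤ) < N := by exact_mod_cast hN
  have hDr : (0 : ℝ) < D := by exact_mod_cast hD
  have hM0 : 0 ≤ M := le_trans (Nat.cast_nonneg _) (hM 0)
  set σ : ℝ := 1 / ((D : ℝ) + L) ^ 2 + 1 / (N * ((D : ℝ) + L)) with hσ
  have hσ0 : 0 ≤ σ := by positivity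
  -- positivity of the distances on the window
  have hdist : ∀ k ∈ W, ∀ l ∈ S, ((D : ℝ) + L ≤ (L₂ : ℝ) + k ∧ (D : ℝ) + L ≤ (L₂ : ℝ) - k) ∧
      ((D : ℝ) ≤ (L₂ : ℝ) + (k - l) ∧ (D : ℝ) ≤ (L₂ : ℝ) - (k - l)) := by
    intro k hk l hl
    have h1 := hW k hk
    have h2 := hS l hl
    have h1' : (|k| : ℝ) + L + D ≤ L₂ := by exact_mod_cast h1
    have h2' : (|l| : ℝ) ≤ L := by exact_mod_cast h2
    rw [← Int.cast_abs] at h1' h2'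
    refine ⟨⟨?_, ?_⟩, ?_, ?_⟩ <;> [skip; skip; skip; skip] <;>
      (have := le_abs_self ((k : ℤ) : ℝ); have := neg_abs_le ((k : ℤ) : ℝ);
       have := le_abs_self ((l : ℤ) : ℝ); have := neg_abs_le ((l : ℤ) : ℝ); push_cast at *; linarith)
  -- the corner phases
  set E : ℂ := Complex.exp (π * I * (L₂ : ℤ) / (2 * N)) with hE
  set E' : ℂ := Complex.exp (-(π * I * (L₂ : ℤ) / (2 * N))) with hE'
  set ω : ℤ → ℂ := fun x => Complex.exp (π * I * x / (2 * N)) with hω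
  set ω' : ℤ → ℂ := fun x => Complex.exp (-(π * I * x / (2 * N))) with hω'
  have hEn : ‖E‖ = 1 := by
    rw [hE, show (π * I * ((L₂ : ℤ) : ℂ) / (2 * N) : ℂ) = ((π * L₂ / (2 * N) : ℝ) : ℂ) * I by push_cast; ring,
      Complex.norm_exp_ofReal_mul_I]
  have hE'n : ‖E'‖ = 1 := by
    rw [hE', show (-(π * I * ((L₂ : ℤ) : ℂ) / (2 * N)) : ℂ) = ((-(π * L₂ / (2 * N)) : ℝ) : ℂ) * I by push_cast; ring,
      Complex.norm_exp_ofReal_mul_I]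
  have hωn : ∀ x, ‖ω x‖ = 1 := fun x => by
    rw [hω]; simp only
    rw [show (π * I * (x : ℂ) / (2 * N) : ℂ) = ((π * x / (2 * N) : ℝ) : ℂ) * I by push_cast; ring, Complex.norm_exp_ofReal_mul_I]
  have hω'n : ∀ x, ‖ω' x‖ = 1 := fun x => by
    rw [hω']; simp only
    rw [show (-(π * I * (x : ℂ) / (2 * N)) : ℂ) = ((-(π * x / (2 * N)) : ℝ) : ℂ) * I by push_cast; ring,
      Complex.norm_exp_ofReal_mul_I]
  -- real kernels
  set Φ : ℤ → ℤ → ℝ := fun k l => (N : ℝ) / (π * ((L₂ : ℝ) + (k - l))) + (N : ℝ) / (π * ((L₂ : ℝ) - (k - l))) with hΦ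
  set Φ₀ : ℤ → ℝ := fun k => (N : ℝ) / (π * ((L₂ : ℝ) + k)) + (N : ℝ) / (π * ((L₂ : ℝ) - k)) with hΦ₀
  -- the per-`k` residue set
  set Sk : ℤ → Finset ℤ := fun k => S.filter fun l => (N : ℤ) ∣ k - l with hSk
  -- Step 1: the term-wise closed form, `X(k) = (1/(2i)) Σ_{l∈S_k} c_l Φ(k,l) (E ω_k ω̄_l − Ē ω̄_k ω_l)`
  have hX : ∀ k ∈ W, ∑ l ∈ S, c l * fourierCoeff g₀ (k - l) =
      (1 / (2 * I)) * ∑ l ∈ Sk k, c l * (Φ k l : ℂ) * (E * ω k * ω' l - E' * ω' k * ω l) := by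
    intro k hk
    rw [Finset.mul_sum]
    rw [← Finset.sum_filter_add_sum_filter_not S (fun l => (N : ℤ) ∣ k - l)]
    have hzero : ∑ l ∈ S.filter (fun l => ¬ (N : ℤ) ∣ k - l), c l * fourierCoeff g₀ (k - l) = 0 := by
      refine Finset.sum_eq_zero fun l hl => ?_
      obtain ⟨hlS, hndvd⟩ := Finset.mem_filter.mp hl
      obtain ⟨-, h3, h4⟩ := hdist k hk l hlS
      rw [fourierCoeff_nTooth_exactChirp hN (L₂ : ℤ) hg₀ (m := k - l)
        (by intro h0; have : ((L₂ : ℝ) + (k - l)) = 0 := by exact_mod_cast h0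
            linarith)
        (by intro h0; have : ((L₂ : ℝ) - (k - l)) = 0 := by exact_mod_cast h0
            linarith), if_neg hndvd, mul_zero]
    rw [hzero, add_zero]
    refine Finset.sum_congr rfl fun l hl => ?_
    obtain ⟨hlS, hdvd⟩ := Finset.mem_filter.mp hl
    obtain ⟨-, h3, h4⟩ := hdist k hk l hlS
    rw [fourierCoeff_nTooth_exactChirp hN (L₂ : ℤ) hg₀ (m := k - l)
      (by intro h0; have : ((L₂ : ℝ) + (k - l)) = 0 := by exact_mod_cast h0
          linarith)
      (by intro h0; have : ((L₂ : ℝ) - (k - l)) = 0 := by exact_mod_cast h0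
          linarith), if_pos hdvd]
    rw [Complex.ofReal_mul, ofReal_sin_corner N (L₂ : ℤ) k l]
    simp only [hΦ, hE, hE', hω, hω']
    push_cast
    field_simp
  -- Step 2: the split `Φ(k,l) = Φ₀(k) + Δ` with `|Δ| ≤ |l|·Φ₀(k)/D`, and the per-`k` norm bound
  set A : ℤ → ℂ := fun k => ∑ l ∈ Sk k, c l * ω' l with hA
  set A' : ℤ → ℂ := fun k => ∑ l ∈ Sk k, c l * ω l with hA'
  set e : ℤ → ℝ := fun k => ∑ l ∈ Sk k, ‖c l‖ ^ 2 with he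
  have hkpos : ∀ k ∈ W, 0 < (L₂ : ℝ) + k ∧ 0 < (L₂ : ℝ) - k := by
    intro k hk
    have h1 := hW k hk
    have h1' : |((k : ℤ) : ℝ)| + L + D ≤ L₂ := by have h := h1; exact_mod_cast h
    have := le_abs_self ((k : ℤ) : ℝ); have := neg_abs_le ((k : ℤ) : ℝ)
    have : (0 : ℝ) ≤ L := Nat.cast_nonneg _
    constructor <;> linarith
  have hΦ₀pos : ∀ k ∈ W, 0 < Φ₀ k := by
    intro k hk
    obtain ⟨hp1, hp2⟩ := hkpos k hk
    simp only [hΦ₀]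
    positivity
  have hΔ : ∀ k ∈ W, ∀ l ∈ Sk k, |Φ k l - Φ₀ k| ≤ (L : ℝ) * Φ₀ k / D := by
    intro k hk l hl
    have hlS : l ∈ S := (Finset.mem_filter.mp hl).1
    obtain ⟨⟨h1, h2⟩, h3, h4⟩ := hdist k hk l hlS
    have hl' : |((l : ℤ) : ℝ)| ≤ L := by have h := hS l hlS; exact_mod_cast h
    have hL0 : (0 : ℝ) ≤ L := Nat.cast_nonneg _
    have hp1 : 0 < (L₂ : ℝ) + k := by linarith
    have hp2 : 0 < (L₂ : ℝ) - k := by linarith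
    have hp3 : 0 < (L₂ : ℝ) + (k - l) := by linarith
    have hp4 : 0 < (L₂ : ℝ) - (k - l) := by linarith
    simp only [hΦ, hΦ₀]
    -- `N/(π(a−l)) − N/(πa) = N l/(π a (a−l))`, `|·| ≤ N L/(π a D)`
    have e1 : (N : ℝ) / (π * ((L₂ : ℝ) + (k - l))) - (N : ℝ) / (π * ((L₂ : ℝ) + k)) =
        (N : ℝ) * l / (π * ((L₂ : ℝ) + k) * ((L₂ : ℝ) + (k - l))) := by field_simp; ring
    have e2 : (N : ℝ) / (π * ((L₂ : ℝ) - (k - l))) - (N : ℝ) / (π * ((L₂ : ℝ) - k)) =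
        -((N : ℝ) * l) / (π * ((L₂ : ℝ) - k) * ((L₂ : ℝ) - (k - l))) := by field_simp; ring
    have hsplit : (N : ℝ) / (π * ((L₂ : ℝ) + (k - l))) + (N : ℝ) / (π * ((L₂ : ℝ) - (k - l))) -
        ((N : ℝ) / (π * ((L₂ : ℝ) + k)) + (N : ℝ) / (π * ((L₂ : ℝ) - k))) =
        (N : ℝ) * l / (π * ((L₂ : ℝ) + k) * ((L₂ : ℝ) + (k - l))) +
          -((N : ℝ) * l) / (π * ((L₂ : ℝ) - k) * ((L₂ : ℝ) - (k - l))) := by linarith [e1, e2]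
    rw [hsplit]
    refine (abs_add_le _ _).trans ?_
    have hb1 : |(N : ℝ) * l / (π * ((L₂ : ℝ) + k) * ((L₂ : ℝ) + (k - l)))| ≤
        (L : ℝ) * N / (π * ((L₂ : ℝ) + k) * D) := by
      rw [abs_div, abs_mul, abs_of_pos hNr, abs_of_pos (by positivity : (0 : ℝ) < π * ((L₂ : ℝ) + k) * ((L₂ : ℝ) + (k - l))),
        div_le_div_iff₀ (by positivity) (by positivity)]
      have h5 := mul_le_mul hl' h3 hDr.le (Nat.cast_nonneg L)
      have h6 : 0 ≤ (N : ℝ) * (π * ((L₂ : ℝ) + k)) := by positivity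
      nlinarith [mul_le_mul_of_nonneg_left h5 h6]
    have hb2 : |-((N : ℝ) * l) / (π * ((L₂ : ℝ) - k) * ((L₂ : ℝ) - (k - l)))| ≤
        (L : ℝ) * N / (π * ((L₂ : ℝ) - k) * D) := by
      rw [abs_div, abs_neg, abs_mul, abs_of_pos hNr,
        abs_of_pos (by positivity : (0 : ℝ) < π * ((L₂ : ℝ) - k) * ((L₂ : ℝ) - (k - l))),
        div_le_div_iff₀ (by positivity) (by positivity)]
      have h5 := mul_le_mul hl' h4 hDr.le (Nat.cast_nonneg L)
      have h6 : 0 ≤ (N : ℝ) * (π * ((L₂ : ℝ) - k)) := by positivity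
      nlinarith [mul_le_mul_of_nonneg_left h5 h6]
    have e3 : (L : ℝ) * N / (π * ((L₂ : ℝ) + k) * D) + (L : ℝ) * N / (π * ((L₂ : ℝ) - k) * D) =
        (L : ℝ) * ((N : ℝ) / (π * ((L₂ : ℝ) + k)) + (N : ℝ) / (π * ((L₂ : ℝ) - k))) / D := by
      field_simp
    linarith [hb1, hb2, e3]
  -- the per-`k` estimate: `‖X(k)‖ ≤ (Φ₀(k)/2)·(‖A k‖ + ‖A' k‖ + 2(L/D)Σ_{S_k}‖c_l‖)`
  have hnormX : ∀ k ∈ W, ‖∑ l ∈ S, c l * fourierCoeff g₀ (k - l)‖ ≤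
      Φ₀ k / 2 * (‖A k‖ + ‖A' k‖ + 2 * ((L : ℝ) / D) * ∑ l ∈ Sk k, ‖c l‖) := by
    intro k hk
    rw [hX k hk, norm_mul]
    have h2I : ‖(1 / (2 * I) : ℂ)‖ = 1 / 2 := by simp
    rw [h2I]
    -- split the sum
    have hsplit : ∑ l ∈ Sk k, c l * (Φ k l : ℂ) * (E * ω k * ω' l - E' * ω' k * ω l) =
        E * ω k * ((Φ₀ k : ℂ) * A k + ∑ l ∈ Sk k, c l * ((Φ k l - Φ₀ k : ℝ) : ℂ) * ω' l) -
          E' * ω' k * ((Φ₀ k : ℂ) * A' k + ∑ l ∈ Sk k, c l * ((Φ k l - Φ₀ k : ℝ) : ℂ) * ω l) := by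
      simp only [hA, hA', Finset.mul_sum, ← Finset.sum_add_distrib, ← Finset.sum_sub_distrib]
      refine Finset.sum_congr rfl fun l _ => ?_
      push_cast; ring
    rw [hsplit]
    have hR : ∀ (w : ℤ → ℂ), (∀ x, ‖w x‖ = 1) →
        ‖∑ l ∈ Sk k, c l * ((Φ k l - Φ₀ k : ℝ) : ℂ) * w l‖ ≤ (L : ℝ) * Φ₀ k / D * ∑ l ∈ Sk k, ‖c l‖ := by
      intro w hw
      rw [Finset.mul_sum]
      refine (norm_sum_le _ _).trans (Finset.sum_le_sum fun l hl => ?_)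
      rw [norm_mul, norm_mul, hw, mul_one, Complex.norm_real, Real.norm_eq_abs, mul_comm]
      exact mul_le_mul_of_nonneg_right (hΔ k hk l hl) (norm_nonneg _)
    have hR1 := hR ω' hω'n
    have hR2 := hR ω hωn
    have hΦ₀k := (hΦ₀pos k hk).le
    calc 1 / 2 * ‖E * ω k * ((Φ₀ k : ℂ) * A k + ∑ l ∈ Sk k, c l * ((Φ k l - Φ₀ k : ℝ) : ℂ) * ω' l) -
          E' * ω' k * ((Φ₀ k : ℂ) * A' k + ∑ l ∈ Sk k, c l * ((Φ k l - Φ₀ k : ℝ) : ℂ) * ω l)‖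
        ≤ 1 / 2 * (‖(Φ₀ k : ℂ) * A k + ∑ l ∈ Sk k, c l * ((Φ k l - Φ₀ k : ℝ) : ℂ) * ω' l‖ +
            ‖(Φ₀ k : ℂ) * A' k + ∑ l ∈ Sk k, c l * ((Φ k l - Φ₀ k : ℝ) : ℂ) * ω l‖) := by
          refine mul_le_mul_of_nonneg_left ((norm_sub_le _ _).trans (add_le_add ?_ ?_)) (by norm_num)
          · rw [norm_mul, norm_mul, hEn, hωn, one_mul, one_mul]
          · rw [norm_mul, norm_mul, hE'n, hω'n, one_mul, one_mul]
      _ ≤ 1 / 2 * ((Φ₀ k * ‖A k‖ + (L : ℝ) * Φ₀ k / D * ∑ l ∈ Sk k, ‖c l‖) +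
            (Φ₀ k * ‖A' k‖ + (L : ℝ) * Φ₀ k / D * ∑ l ∈ Sk k, ‖c l‖)) := by
          refine mul_le_mul_of_nonneg_left (add_le_add ((norm_add_le _ _).trans (add_le_add ?_ hR1))
            ((norm_add_le _ _).trans (add_le_add ?_ hR2))) (by norm_num)
          · rw [norm_mul, Complex.norm_real, Real.norm_eq_abs, abs_of_nonneg hΦ₀k]
          · rw [norm_mul, Complex.norm_real, Real.norm_eq_abs, abs_of_nonneg hΦ₀k]
      _ = Φ₀ k / 2 * (‖A k‖ + ‖A' k‖ + 2 * ((L : ℝ) / D) * ∑ l ∈ Sk k, ‖c l‖) := by ring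
  -- Step 3: square, with Cauchy–Schwarz on the residue class
  have hsqX : ∀ k ∈ W, ‖∑ l ∈ S, c l * fourierCoeff g₀ (k - l)‖ ^ 2 ≤
      3 * (Φ₀ k / 2) ^ 2 * (‖A k‖ ^ 2 + ‖A' k‖ ^ 2 + 4 * (L : ℝ) ^ 2 * M / D ^ 2 * e k) := by
    intro k hk
    have h1 := hnormX k hk
    have hΦ₀k := (hΦ₀pos k hk).le
    have hCS : (∑ l ∈ Sk k, ‖c l‖) ^ 2 ≤ M * e k := by
      have h := Finset.sum_mul_sq_le_sq_mul_sq (Sk k) (fun _ => (1 : ℝ)) (fun l => ‖c l‖)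
      simp only [one_mul, one_pow, Finset.sum_const, nsmul_eq_mul, mul_one] at h
      exact h.trans (mul_le_mul_of_nonneg_right (hM k) (Finset.sum_nonneg fun _ _ => sq_nonneg _))
    have hs0 : 0 ≤ ∑ l ∈ Sk k, ‖c l‖ := Finset.sum_nonneg fun _ _ => norm_nonneg _
    set xa : ℝ := ‖A k‖ with hxa
    set xb : ℝ := ‖A' k‖ with hxb
    set xc : ℝ := 2 * ((L : ℝ) / D) * ∑ l ∈ Sk k, ‖c l‖ with hxc
    have h3 : (xa + xb + xc) ^ 2 ≤ 3 * (xa ^ 2 + xb ^ 2 + 4 * (L : ℝ) ^ 2 * M / D ^ 2 * e k) := by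
      have hx : xc ^ 2 ≤ 4 * (L : ℝ) ^ 2 * M / D ^ 2 * e k := by
        rw [hxc, mul_pow, mul_pow, div_pow]
        have : (0 : ℝ) ≤ 2 ^ 2 * ((L : ℝ) ^ 2 / D ^ 2) := by positivity
        calc (2 : ℝ) ^ 2 * ((L : ℝ) ^ 2 / D ^ 2) * (∑ l ∈ Sk k, ‖c l‖) ^ 2
            ≤ 2 ^ 2 * ((L : ℝ) ^ 2 / D ^ 2) * (M * e k) := mul_le_mul_of_nonneg_left hCS this
          _ = 4 * (L : ℝ) ^ 2 * M / D ^ 2 * e k := by ring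
      have h31 : (xa + xb + xc) ^ 2 ≤ 3 * (xa ^ 2 + xb ^ 2 + xc ^ 2) := by
        nlinarith [sq_nonneg (xa - xb), sq_nonneg (xa - xc), sq_nonneg (xb - xc)]
      linarith
    calc ‖∑ l ∈ S, c l * fourierCoeff g₀ (k - l)‖ ^ 2
        ≤ (Φ₀ k / 2 * (xa + xb + xc)) ^ 2 := pow_le_pow_left₀ (norm_nonneg _) h1 2
      _ = (Φ₀ k / 2) ^ 2 * (xa + xb + xc) ^ 2 := by ring
      _ ≤ (Φ₀ k / 2) ^ 2 * (3 * (xa ^ 2 + xb ^ 2 + 4 * (L : ℝ) ^ 2 * M / D ^ 2 * e k)) :=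
          mul_le_mul_of_nonneg_left h3 (sq_nonneg _)
      _ = 3 * (Φ₀ k / 2) ^ 2 * (xa ^ 2 + xb ^ 2 + 4 * (L : ℝ) ^ 2 * M / D ^ 2 * e k) := by ring
  intro k hk
  exact hsqX k hk

end Summit.AnomalousDissipation.AnomalousDissipation.Theorems.SawtoothPulseCascade.K1Window
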